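import Mathlib.RingTheory.Etale.Field
import Mathlib.FieldTheory.PrimitiveElement
import Mathlib.RingTheory.AdjoinRoot
import Mathlib.RingTheory.Adjoin.PowerBasis
import Mathlib.FieldTheory.Minpoly.Field
import HarnessLib

/-!
# Finite étale algebras over a field of characteristic zero are monogenic

For a field `K` of characteristic `0` and an étale `K`-algebra `L` (equivalently, by
`Algebra.Etale.iff_exists_algEquiv_prod`, a finite product of finite separable field extensions),
there is a monic separable polynomial `f ∈ K[X]` of degree `dim_K L` with `L ≃ₐ[K] K[X]/(f)`
(`exists_adjoinRoot_algEquiv_of_etale`): the primitive element theorem for étale algebras.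

Proof: write `L ≃ Π_i A_i` with `A_i/K` finite separable, pick primitive elements `α_i`
(`Field.powerBasisOfFiniteOfSeparable`) and replace them by translates `β_i = α_i + N·ι(i)`
(`ι` an injection into `ℕ`, `N ∈ ℕ`) so that the minimal polynomials `m_i(X) = m_{α_i}(X - N ι(i))`
are pairwise DISTINCT — possible because a non-constant polynomial has at most one translate equal
to a given polynomial (`comp_X_sub_C_injective`, characteristic `0`), so only finitely many `N` are
bad; distinct monic irreducibles are coprime, `f = Π m_i` is separable and `K[X]/(f) → Π A_i`,
`X ↦ (β_i)_i` is injective between spaces of equal dimension.  [folklore; cf. Bourbaki, Algèbre V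
§7 no. 6 for the field case]

## Main statements

* `comp_X_sub_C_eq_self_iff`: for `p` non-constant over a field of characteristic `0`,
  `p(X - δ) = p ↔ δ = 0`;
* `exists_adjoinRoot_algEquiv_of_etale`: the monogenicity theorem.
-/

namespace Literature.FieldTheory.Separability

open Polynomial

universe u

section Shift

variable {K : Type*} [Field K] [CharZero K]

/-- A non-constant polynomial over a field of characteristic `0` is not invariant under a non-zero
translation of the variable: `p(X - δ) = p ↔ δ = 0` (else `p - p(0)` would vanish on `ℕ δ`).
[folklore] -/
theorem comp_X_sub_C_eq_self_iff {p : K[X]} (hp : 0 < p.natDegree) (δ : K) :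
    p.comp (X - C δ) = p ↔ δ = 0 := by
  constructor
  · intro h
    by_contra hδ
    -- `p` takes the value `p(0)` at every `n • δ`
    have hval : ∀ n : ℕ, p.eval ((n : K) * δ) = p.eval 0 := by
      intro n
      induction n with
      | zero => simp
      | succ n ih =>
        have := congrArg (Polynomial.eval (((n + 1 : ℕ) : K) * δ)) h
        rw [eval_comp, eval_sub, eval_X, eval_C] at this
        rw [← this, ← ih]
        congr 1
        push_cast
        ring
    have hinf : Set.Infinite {x : K | IsRoot (p - C (p.eval 0)) x} := by
      have hsub : Set.range (fun n : ℕ => (n : K) * δ) ⊆ {x : K | IsRoot (p - C (p.eval 0)) x} := by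
        rintro _ ⟨n, rfl⟩
        simp [IsRoot, hval n]
      refine Set.Infinite.mono hsub (Set.infinite_range_of_injective ?_)
      intro n m hnm
      have : (n : K) = m := mul_right_cancel₀ hδ hnm
      exact_mod_cast this
    have hzero := Polynomial.eq_zero_of_infinite_isRoot _ hinf
    rw [sub_eq_zero] at hzero
    have := congrArg natDegree hzero
    rw [natDegree_C] at this
    omega
  · rintro rfl
    simp

/-- Distinct translates of a non-constant polynomial are distinct: `c ↦ p(X - c)` is injective
(characteristic `0`). [folklore] -/
theorem comp_X_sub_C_injective {p : K[X]} (hp : 0 < p.natDegree) :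
    Function.Injective fun c : K => p.comp (X - C c) := by
  intro c c' h
  have h' := congrArg (fun q : K[X] => q.comp (X + C c')) h
  simp only [comp_assoc, sub_comp, X_comp, C_comp] at h'
  have e1 : X + C c' - C c = X - C (c - c') := by
    rw [C_sub]
    ring
  have e2 : X + C c' - C c' = (X : K[X]) := by ring
  rw [e1, e2, comp_X] at h'
  have := (comp_X_sub_C_eq_self_iff hp (c - c')).mp h'
  exact sub_eq_zero.mp this

end Shift

section Monogenic

variable (K : Type u) [Field K] [CharZero K] (L : Type u) [CommRing L] [Algebra K L]

/-- **Finite étale algebras over a field of characteristic zero are monogenic.**  If `L` is an étale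
`K`-algebra, `char K = 0`, there is a monic separable `f ∈ K[X]` with `deg f = dim_K L` and
`K[X]/(f) ≃ₐ[K] L`. [folklore] -/
theorem exists_adjoinRoot_algEquiv_of_etale [Algebra.Etale K L] :
    ∃ f : K[X], f.Monic ∧ f.Separable ∧ f.natDegree = Module.finrank K L ∧
      Nonempty (AdjoinRoot f ≃ₐ[K] L) := by
  classical
  obtain ⟨I, hI, A, hAf, hAa, e, hA⟩ := (Algebra.Etale.iff_exists_algEquiv_prod K L).mp inferInstance
  haveI := Fintype.ofFinite I
  haveI hfin : ∀ i, Module.Finite K (A i) := fun i => (hA i).1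
  haveI hsep : ∀ i, Algebra.IsSeparable K (A i) := fun i => (hA i).2
  -- primitive elements
  let pb : ∀ i, PowerBasis K (A i) := fun i => Field.powerBasisOfFiniteOfSeparable K (A i)
  -- an injection `ι : I → ℕ`
  obtain ⟨n, ⟨eqv⟩⟩ := Finite.exists_equiv_fin I
  let ι : I → ℕ := fun i => (eqv i : ℕ)
  have hι : Function.Injective ι := fun i j h => eqv.injective (Fin.ext h)
  -- translated generators and their minimal polynomials
  let β : ℕ → ∀ i, A i := fun N i => (pb i).gen + algebraMap K (A i) ((N * ι i : ℕ) : K)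
  let m : ℕ → I → K[X] := fun N i => minpoly K (β N i)
  have hm : ∀ N i, m N i = (minpoly K (pb i).gen).comp (X - C ((N * ι i : ℕ) : K)) :=
    fun N i => minpoly.add_algebraMap _ _
  have hdegpos : ∀ i, 0 < (minpoly K (pb i).gen).natDegree :=
    fun i => minpoly.natDegree_pos (Algebra.IsIntegral.isIntegral _)
  -- only finitely many `N` make two of the `m N i` coincide
  have hbad : Set.Finite {N : ℕ | ∃ i j, i ≠ j ∧ m N i = m N j} := by
    have hsub : {N : ℕ | ∃ i j, i ≠ j ∧ m N i = m N j} ⊆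
        ⋃ i, ⋃ j, {N : ℕ | i ≠ j ∧ m N i = m N j} := by
      intro N hN
      obtain ⟨i, j, hij, hN⟩ := hN
      simp only [Set.mem_iUnion, Set.mem_setOf_eq]
      exact ⟨i, j, hij, hN⟩
    refine Set.Finite.subset (Set.finite_iUnion fun i => Set.finite_iUnion fun j => ?_) hsub
    refine Set.Subsingleton.finite ?_
    intro N hN N' hN'
    obtain ⟨hij, hN⟩ := hN
    obtain ⟨-, hN'⟩ := hN'
    -- translate back by `N ι i`, resp. `N' ι i`
    have key : ∀ M : ℕ, m M i = m M j →
        (minpoly K (pb i).gen) =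
          (minpoly K (pb j).gen).comp (X - C ((M : K) * ((ι j : K) - (ι i : K)))) := by
      intro M hM
      rw [hm, hm] at hM
      have h' := congrArg (fun q : K[X] => q.comp (X + C ((M * ι i : ℕ) : K))) hM
      simp only [comp_assoc, sub_comp, X_comp, C_comp] at h'
      have e1 : X + C ((M * ι i : ℕ) : K) - C ((M * ι i : ℕ) : K) = (X : K[X]) := by ring
      have e2 : X + C ((M * ι i : ℕ) : K) - C ((M * ι j : ℕ) : K) =
          X - C ((M : K) * ((ι j : K) - (ι i : K))) := by
        simp only [Nat.cast_mul, map_mul, map_sub, map_natCast]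
        ring
      rw [e1, comp_X, e2] at h'
      exact h'
    have h1 := key N hN
    have h2 := key N' hN'
    rw [h1] at h2
    have h3 := comp_X_sub_C_injective (hdegpos j) h2
    have hne : (ι j : K) - (ι i : K) ≠ 0 := by
      intro h0
      apply hij
      apply hι
      have : (ι j : K) = ι i := sub_eq_zero.mp h0
      exact_mod_cast this.symm
    have : (N : K) = N' := mul_right_cancel₀ hne h3
    exact_mod_cast this
  obtain ⟨N, hN⟩ := hbad.exists_notMem
  simp only [Set.mem_setOf_eq, not_exists, not_and] at hN
  -- the minimal polynomials `m N i` are pairwise coprime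
  have hmonic : ∀ i, (m N i).Monic := fun i => minpoly.monic (Algebra.IsIntegral.isIntegral _)
  have hirr : ∀ i, Irreducible (m N i) := fun i => minpoly.irreducible (Algebra.IsIntegral.isIntegral _)
  have hcop : Pairwise fun i j => IsCoprime (m N i) (m N j) := by
    intro i j hij
    rw [(hirr i).coprime_iff_not_dvd]
    intro hdvd
    apply hN i j hij
    exact eq_of_monic_of_associated (hmonic i) (hmonic j)
      ((hirr i).associated_of_dvd (hirr j) hdvd)
  -- the polynomial `f`
  let f : K[X] := ∏ i, m N i
  have hfmonic : f.Monic := monic_prod_of_monic _ _ fun i _ => hmonic i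
  have hfsep : f.Separable :=
    separable_prod (f := fun i => m N i) hcop fun i => Algebra.IsSeparable.isSeparable K (β N i)
  -- degrees
  have hadj : ∀ i, Algebra.adjoin K {β N i} = ⊤ := by
    intro i
    rw [_root_.eq_top_iff, ← (pb i).adjoin_gen_eq_top, Algebra.adjoin_le_iff, Set.singleton_subset_iff]
    have : (pb i).gen = β N i - algebraMap K (A i) ((N * ι i : ℕ) : K) := by
      simp [β]
    rw [this]
    exact Subalgebra.sub_mem _ (Algebra.self_mem_adjoin_singleton K _)
      (Subalgebra.algebraMap_mem _ _)
  let pbβ : ∀ i, PowerBasis K (A i) :=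
    fun i => PowerBasis.ofAdjoinEqTop (Algebra.IsIntegral.isIntegral (β N i)) (hadj i)
  have hdim : ∀ i, Module.finrank K (A i) = (m N i).natDegree := by
    intro i
    rw [(pbβ i).finrank, PowerBasis.ofAdjoinEqTop_dim]
  have hfdeg : f.natDegree = Module.finrank K (∀ i, A i) := by
    rw [Module.finrank_pi_fintype, natDegree_prod_of_monic _ _ fun i _ => hmonic i]
    exact Finset.sum_congr rfl fun i _ => (hdim i).symm
  have hf0 : f ≠ 0 := hfmonic.ne_zero
  -- the map `K[X]/(f) → Π A i`
  have hroot : f.eval₂ (Algebra.ofId K (∀ i, A i)) (β N) = 0 := by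
    change f.eval₂ (algebraMap K (∀ i, A i)) (β N) = 0
    rw [← aeval_def]
    funext i
    rw [← Pi.evalAlgHom_apply K A i (aeval (β N) f), ← aeval_algHom_apply, Pi.evalAlgHom_apply,
      map_prod]
    exact Finset.prod_eq_zero (Finset.mem_univ i) (minpoly.aeval K (β N i))
  let Φ : AdjoinRoot f →ₐ[K] (∀ i, A i) := AdjoinRoot.liftAlgHom f (Algebra.ofId K _) (β N) hroot
  have hΦinj : Function.Injective Φ := by
    rw [injective_iff_map_eq_zero]
    intro z hz
    induction z using AdjoinRoot.induction_on with
    | ih g =>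
      rw [AdjoinRoot.liftAlgHom_mk] at hz
      change g.eval₂ (algebraMap K (∀ i, A i)) (β N) = 0 at hz
      rw [← aeval_def] at hz
      apply AdjoinRoot.mk_eq_zero.mpr
      apply Fintype.prod_dvd_of_coprime hcop
      intro i
      apply minpoly.dvd
      have := congrArg (Pi.evalAlgHom K A i) hz
      rwa [← aeval_algHom_apply, Pi.evalAlgHom_apply, map_zero] at this
  haveI : Module.Finite K (AdjoinRoot f) := (AdjoinRoot.powerBasis hf0).finite
  have hΦbij : Function.Bijective Φ := by
    refine ⟨hΦinj, ?_⟩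
    exact (LinearMap.injective_iff_surjective_of_finrank_eq_finrank (f := Φ.toLinearMap)
      (by rw [(AdjoinRoot.powerBasis hf0).finrank, AdjoinRoot.powerBasis_dim, hfdeg])).mp hΦinj
  refine ⟨f, hfmonic, hfsep, ?_, ⟨(AlgEquiv.ofBijective Φ hΦbij).trans e.symm⟩⟩
  rw [hfdeg]
  exact e.symm.toLinearEquiv.finrank_eq

end Monogenic

end Literature.FieldTheory.Separability
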